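import Summits.QuantumAdvantage.QuantumAdvantage.Theorems.CubicForrelationNearExactIsExactTwelveLevelFiveAlphaFlat

/-!
# Crux `CubicForrelation.NearExactIsExact` (stmt-QuantumAdvantage-14043) — n = 12, open window, a LEVEL-5 side in CASE α: the modified (H3) —
  the 3-flat parities of the sign bit on `P` equal the 3-flat parities of `A₂` on the parallel off-`P` flat

Certificate seat `b2b-cforr-cert` (gen 29).  HONEST FRAMING: kernel-checked finite-slice lemma (standard axioms) about cubic Boolean pairs on 12 bits;
first brick of PLAN-N12-WINDOW-ALPHA.md §A1 for the only level-5 configuration left on the open window after gen 29 (case α: `A₂ = {4 ∤ e₅}` off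
`P` non-empty, an 8-flat by `tza_A2_flat`).  In the generic/rigid cases `4 ∣ e₅` off `P` gave (H3) `4 ∣ Σ_{3-flat ⊂ P} e₅` (`tzl5_H3`), i.e. the
sign bit `hb = [e₅ ≡ 3 (4)]` is relatively quadratic on `P`; in case α the same 4-flat congruence (`l5c_flat4`) says instead that the parity of
`#{hb = 1}` on a 3-flat `x ⊕ ⟨a,b,d⟩ ⊂ P` equals the parity of `#(A₂ ∩ ((x ⊕ t) ⊕ ⟨a,b,d⟩))` for EVERY transversal `t ∉ V`.  NO value of `θ₁₂`
is claimed; NOT summit progress.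

* `tzw_alpha_H3`: the parity transfer `#{ε : hb(x ⊕ ε·(a,b,d))} ≡ #{ε : 4 ∤ e₅((x ⊕ t) ⊕ ε·(a,b,d))} (mod 2)`.

References: J. Ax (1964) / R. J. McEliece (1972) (the flat congruences, in the tree as `l5c_flat4`); MacWilliams–Sloane (1977) Ch. 13 §3, Ch. 15 §2.
Axioms: the standard three.
-/

set_option linter.dupNamespace false -- D-0017: single-problem summit ⇒ `QuantumAdvantage.QuantumAdvantage` by design

noncomputable section

namespace Summit.QuantumAdvantage.QuantumAdvantage.Theorems.CubicForrelation.NearExactIsExact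

open Finset
open Literature.Computability.QuantumComplexity
open Literature.Computability.QuantumComplexity.BuzetChailloux (bxor zeroVec bxor_bxor_cancel_left bxor_zeroVec zeroVec_bxor bxor_comm
  bxor_self)
open Literature.Computability.QuantumComplexity.DerivativeWalsh (W)

/-- **(H3) in case α — parity transfer across the hyperplane.**  Cubic `f, g` on 12 bits, `W_g = 32u'`, `P = {u' odd} = x₀ ⊕ V`
(`#V = 2048`), `hb = [e₅ ≡ 3 (mod 4)]`, `x ∈ P`, `a, b, d ∈ V`, `t ∉ V`.  Then the number of parameters `ε ∈ 𝔽₂³` with `hb(x ⊕ ε·(a,b,d)) = 1`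
and the number with `4 ∤ e₅((x ⊕ ε·(a,b,d)) ⊕ t)` (points of the parallel 3-flat off `P`) have the same parity.  [`4 ∣ Σ` over the 4-flat
`x ⊕ ⟨t,a,b,d⟩` (`l5c_flat4`), `e₅ ≡ σ₅ = 1 − 2·hb (mod 4)` on `P`, `e₅ ≡ 2·[4 ∤ e₅] (mod 4)` off `P`.] [this work] -/
theorem tzw_alpha_H3 (f g : (Fin (6 + 6) → Bool) → Bool) (hf : IsDegLeFun 3 f) (hg : IsDegLeFun 3 g)
    (u' : (Fin (6 + 6) → Bool) → ℤ) (hu' : ∀ x, W (fun y => signOf (g y)) x = (2 : ℝ) ^ 5 * (u' x : ℝ))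
    (V : Finset (Fin (6 + 6) → Bool)) (x₀ : Fin (6 + 6) → Bool) (h0 : zeroVec ∈ V) (hadd : ∀ a ∈ V, ∀ b ∈ V, bxor a b ∈ V)
    (hP : (univ.filter fun x : Fin (6 + 6) → Bool => Odd (u' x)) = V.image (bxor x₀))
    (hb : (Fin (6 + 6) → Bool) → Bool) (hhb : ∀ z, hb z = decide ((u' z - 2 * sZ (f z)) % 4 = 3))
    {x a b d t : Fin (6 + 6) → Bool} (hx : Odd (u' x)) (ha : a ∈ V) (hbV : b ∈ V) (hd : d ∈ V) (ht : t ∉ V) :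
    Even #(univ.filter fun ε : Fin 3 → Bool => hb (fun j => x j ^^ decide (Odd #(univ.filter fun i => ε i && (![a, b, d] : Fin 3 → Fin (6 + 6) → Bool) i j))) = true) ↔
      Even #(univ.filter fun ε : Fin 3 → Bool =>
        ¬ (4 : ℤ) ∣ u' (bxor (fun j => x j ^^ decide (Odd #(univ.filter fun i => ε i && (![a, b, d] : Fin 3 → Fin (6 + 6) → Bool) i j))) t) - 2 * sZ (f (bxor (fun j => x j ^^ decide (Odd #(univ.filter fun i => ε i && (![a, b, d] : Fin 3 → Fin (6 + 6) → Bool) i j))) t))) := by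
  classical
  set P := univ.filter (fun x : Fin (6 + 6) → Bool => Odd (u' x)) with hPdef
  set e : (Fin (6 + 6) → Bool) → ℤ := fun x => u' x - 2 * sZ (f x) with hedef
  have hxP : x ∈ P := mem_filter.2 ⟨mem_univ _, hx⟩
  have hPV : ∀ x, x ∈ P → ∀ a ∈ V, bxor x a ∈ P := fun x hx a ha => fl1_coset_vadd hadd hP hx ha
  -- the 4-flat congruence, peeled along `t`
  have h4 := l5c_flat4 f g hf hg u' hu' x ![t, a, b, d]
  have e4 : (![t, a, b, d] : Fin 4 → Fin (6 + 6) → Bool) = Matrix.vecCons t ![a, b, d] := rfl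
  change (4 : ℤ) ∣ ∑ ε : Fin 4 → Bool, e (fun j => x j ^^ decide (Odd #(univ.filter fun i =>
        ε i && (![t, a, b, d] : Fin 4 → Fin (6 + 6) → Bool) i j))) at h4
  rw [e4, fr_sum_peel e x t ![a, b, d]] at h4
  have hin : ∀ ε : Fin 3 → Bool, (fun j => x j ^^ decide (Odd #(univ.filter fun i => ε i && (![a, b, d] : Fin 3 → Fin (6 + 6) → Bool) i j))) ∈ P :=
    fun ε => fr_mem_flatPt3 V h0 (· ∈ P) hPV hxP ![a, b, d] (fun i => by fin_cases i <;> assumption) ε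
  have hout : ∀ ε : Fin 3 → Bool, bxor (fun j => x j ^^ decide (Odd #(univ.filter fun i => ε i && (![a, b, d] : Fin 3 → Fin (6 + 6) → Bool) i j))) t ∉ P := fun ε => fl1_coset_out h0 hadd hP (hin ε) ht
  -- on `P`: `e = (1 − 2·hb) + 4k`
  have hk : ∀ ε : Fin 3 → Bool, ∃ k : ℤ, e (fun j => x j ^^ decide (Odd #(univ.filter fun i => ε i && (![a, b, d] : Fin 3 → Fin (6 + 6) → Bool) i j))) = 1 - 2 * (if hb (fun j => x j ^^ decide (Odd #(univ.filter fun i => ε i && (![a, b, d] : Fin 3 → Fin (6 + 6) → Bool) i j))) = true then (1 : ℤ) else 0) + 4 * k := by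
    intro ε
    have hodd : Odd (u' (fun j => x j ^^ decide (Odd #(univ.filter fun i => ε i && (![a, b, d] : Fin 3 → Fin (6 + 6) → Bool) i j)))) := (mem_filter.1 (hin ε)).2
    obtain ⟨k, hk⟩ := tzl5_mod4 f u' hodd
    refine ⟨k, ?_⟩
    rw [hhb]
    have hs : sZ (decide ((u' (fun j => x j ^^ decide (Odd #(univ.filter fun i => ε i && (![a, b, d] : Fin 3 → Fin (6 + 6) → Bool) i j))) - 2 * sZ (f (fun j => x j ^^ decide (Odd #(univ.filter fun i => ε i && (![a, b, d] : Fin 3 → Fin (6 + 6) → Bool) i j))))) % 4 = 3)) =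
        1 - 2 * (if decide ((u' (fun j => x j ^^ decide (Odd #(univ.filter fun i => ε i && (![a, b, d] : Fin 3 → Fin (6 + 6) → Bool) i j))) - 2 * sZ (f (fun j => x j ^^ decide (Odd #(univ.filter fun i => ε i && (![a, b, d] : Fin 3 → Fin (6 + 6) → Bool) i j))))) % 4 = 3) = true then (1 : ℤ) else 0) := by
      cases decide ((u' (fun j => x j ^^ decide (Odd #(univ.filter fun i => ε i && (![a, b, d] : Fin 3 → Fin (6 + 6) → Bool) i j))) - 2 * sZ (f (fun j => x j ^^ decide (Odd #(univ.filter fun i => ε i && (![a, b, d] : Fin 3 → Fin (6 + 6) → Bool) i j))))) % 4 = 3) <;> simp [sZ]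
    simp only [e]
    linarith
  choose k hk using hk
  -- off `P`: `e = 2m`
  have hm : ∀ ε : Fin 3 → Bool, ∃ m : ℤ, e (bxor (fun j => x j ^^ decide (Odd #(univ.filter fun i => ε i && (![a, b, d] : Fin 3 → Fin (6 + 6) → Bool) i j))) t) = 2 * m := by
    intro ε
    have hne : ¬ Odd (u' (bxor (fun j => x j ^^ decide (Odd #(univ.filter fun i => ε i && (![a, b, d] : Fin 3 → Fin (6 + 6) → Bool) i j))) t)) := fun h => hout ε (mem_filter.2 ⟨mem_univ _, h⟩)
    obtain ⟨m, hm⟩ := Int.not_odd_iff_even.1 hne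
    exact ⟨m - sZ (f (bxor (fun j => x j ^^ decide (Odd #(univ.filter fun i => ε i && (![a, b, d] : Fin 3 → Fin (6 + 6) → Bool) i j))) t)), by simp only [e]; rw [hm]; ring⟩
  choose m hm using hm
  have hm4 : ∀ ε : Fin 3 → Bool, (¬ (4 : ℤ) ∣ e (bxor (fun j => x j ^^ decide (Odd #(univ.filter fun i => ε i && (![a, b, d] : Fin 3 → Fin (6 + 6) → Bool) i j))) t)) ↔ Odd (m ε) := by
    intro ε
    rw [hm ε, Int.odd_iff]
    constructor
    · intro h; by_contra hne; exact h ⟨m ε / 2, by omega⟩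
    · rintro h ⟨j, hj⟩; omega
  -- rewrite the two sums
  rw [sum_congr rfl (fun ε _ => hk ε), sum_congr rfl (fun ε _ => hm ε)] at h4
  rw [sum_add_distrib, sum_sub_distrib, sum_const, card_univ, ← mul_sum, ← mul_sum, ← mul_sum] at h4
  simp only [Fintype.card_fun, Fintype.card_bool, Fintype.card_fin] at h4
  rw [sum_boole] at h4
  have hfilt : (univ.filter fun ε : Fin 3 → Bool => ¬ (4 : ℤ) ∣ u' (bxor (fun j => x j ^^ decide (Odd #(univ.filter fun i => ε i && (![a, b, d] : Fin 3 → Fin (6 + 6) → Bool) i j))) t) - 2 * sZ (f (bxor (fun j => x j ^^ decide (Odd #(univ.filter fun i => ε i && (![a, b, d] : Fin 3 → Fin (6 + 6) → Bool) i j))) t))) =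
      univ.filter fun ε : Fin 3 → Bool => Odd (m ε) := filter_congr fun ε _ => hm4 ε
  rw [hfilt, ← tw_even_sum_iff]
  -- parity bookkeeping
  set N := #(univ.filter fun ε : Fin 3 → Bool => hb (fun j => x j ^^ decide (Odd #(univ.filter fun i => ε i && (![a, b, d] : Fin 3 → Fin (6 + 6) → Bool) i j))) = true) with hN
  obtain ⟨q, hq⟩ := h4
  simp only [nsmul_eq_mul] at hq
  norm_num at hq
  rw [Nat.even_iff, Int.even_iff]
  constructor
  · intro hN2; omega
  · intro hM2; omega

end Summit.QuantumAdvantage.QuantumAdvantage.Theorems.CubicForrelation.NearExactIsExact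

end
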